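import Summits.CriticalPhenomena.PercolationContinuityZ3.Theorems.PercNearOneGluingNoHeavyLowerTailSahiC3CubeCertCheck
import Summits.CriticalPhenomena.PercolationContinuityZ3.Theorems.PercNearOneGluingNoHeavyLowerTailSahiC4CubeLeThree

/-!
# `NoHeavyLowerTail` (crux stmt-CriticalPhenomena-4575), Sahi / Kahn positivity: KERNEL CHECK of the two transport certificates
# on the cube `2^3` (first-slot types `a ∨ bc` and majority)

Support file (cell `prim-l12`, seat P3, gen 4; `--supports stmt-CriticalPhenomena-4575`).  No `sorry`, no named facts; the two
evaluations (`checkOrAndRow_*`, `checkMajRow_*`, twenty rows each) are by `decide +kernel` (standard axioms).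

`…SahiTransportCert` reduces Kahn's Conjecture 5 / Sahi's `C₃` for a first slot determined by a block of `k` coordinates (the
other two slots ARBITRARY increasing events, any dimension) to a TRANSPORT CERTIFICATE on the pattern cube `2^{Fin k}`: a kernel
`Π` with prescribed row sums, bounded column sums, and the transport condition (TC) — for `k = 3`, one polynomial inequality in
`(p_a,p_b,p_c) ∈ [0,1]³` of multidegree `≤ 3` for each of the `20 × 20` pairs of up-sets `(𝒳, 𝒵)` of `2^3`.  This file checks, in
the kernel, the two certificates found by this seat (exact LP + tensor-Bernstein census, HOME code/bern3.py: all `2 × 210 × 64`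
degree-3 coefficients `≥ 0`):
* type `a ∨ bc` (`H = {a, ab, ac, bc, abc}`, bitmask `234`): `Π(∅,a) = w(∅)p_a`, `Π(∅,bc) = w(∅)w(bc)`, `Π(b,ab) = w(b)p_a`,
  `Π(b,bc) = w(b)w(bc)`, `Π(c,ac) = w(c)p_a`, `Π(c,bc) = w(c)w(bc)` ("join the pattern with `a` if the fresh `H`-sample contains
  `a`, else go to `bc`");
* MAJORITY (`H = {ab, ac, bc, abc}`, bitmask `232`): `Π(∅,m) = w(∅)(w(m) + w(abc)/3)`, `Π(x, x∪y) = w(x)(w(xy) + (w(abc) + w(m̄_x))/2)`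
  (`m̄_x` the middle-layer pattern avoiding `x`).
Method = the Richards-comb digit test of `…SahiC3CubeCertCheck` / `…CovTransferCertAlgebra`, generalised from the five terms of `E₃`
to an arbitrary signed VECTOR of products of three bitmask tables (`vecForm`, `checkVec`, `checkVec_sound`): the polynomial is a
`cubicForm`, nonnegative on `[0,1]^m` as soon as its `4^m` three-copy fibre sums (degree-3 tensor-Bernstein coefficients) are, and
these are the base-`2^σ` digits of one Kronecker number.  `vecForm_orAnd`, `vecForm_maj` spell the checked polynomials out:
`6·[(1+δ)(w(𝒳∩𝒵) − w(𝒳)w(𝒵) − w(D∩𝒳∩𝒵)) + w(𝒳)w(D∩𝒵) + w(𝒵)w(D∩𝒳)] − 6·Σ_{T ∈ 𝒳∩𝒵} Π(D,T) ≥ 0` (`D = Hᶜ`, `w` = `ML` of a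
bitmask table), which `…SahiJuntaSlotThree` turns into `TransportCert`s and into Kahn's conjecture for these first slots. [this work]
-/

namespace Summit.CriticalPhenomena.PercolationContinuityZ3.Theorems.SahiTransportCheck

open Finset OneCutCert CovTransferCert SahiC3Cube
open scoped BigOperators

/-! ## Signed vectors of cubic bitmask terms and their digit test -/

/-- The certificate number of a term vector: `Σ_j s_j · K(T₁ j) K(T₂ j) K(T₃ j)` (Kronecker numbers in base `2^σ`). [this work] -/
def zVec (σ m : ℕ) {n : ℕ} (s : Fin n → ℤ) (T₁ T₂ T₃ : Fin n → ℕ) : ℤ :=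
  (List.ofFn fun j => s j * ((krT σ m (T₁ j) : ℤ) * (krT σ m (T₂ j) : ℤ) * (krT σ m (T₃ j) : ℤ))).sum

/-- `Σ_j |s_j|`. [this work] -/
def absVec {n : ℕ} (s : Fin n → ℤ) : ℕ := (List.ofFn fun j => (s j).natAbs).sum

/-- The digit test with precomputed offset. [this work] -/
def checkVecW (σ m : ℕ) (off : ℤ) (offN : ℕ) {n : ℕ} (s : Fin n → ℤ) (T₁ T₂ T₃ : Fin n → ℕ) : Bool :=
  let Z := zVec σ m s T₁ T₂ T₃ + off
  decide (0 ≤ Z) && decide ((Z.toNat &&& offN) = offN)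

/-- The certificate CHECK of a term vector: coefficient bound `B·8^m < 2^(σ−1)` with `Σ|s_j| ≤ B`, and the AND-mask digit test. [this work] -/
def checkVec (σ m B : ℕ) {n : ℕ} (s : Fin n → ℤ) (T₁ T₂ T₃ : Fin n → ℕ) : Bool :=
  decide (0 < σ) && decide (B * 8 ^ m < 2 ^ (σ - 1)) && decide (absVec s ≤ B) &&
    checkVecW σ m (offT σ m) (offT σ m).toNat s T₁ T₂ T₃

/-- The real cubic polynomial of a term vector: `Σ_j s_j · ML(T₁ j) ML(T₂ j) ML(T₃ j)`. [this work] -/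
noncomputable def vecForm (m : ℕ) {n : ℕ} (s : Fin n → ℤ) (T₁ T₂ T₃ : Fin n → ℕ) (x : Fin m → ℝ) : ℝ :=
  ∑ j, (s j : ℝ) * (ML (tabR m (T₁ j)) x * ML (tabR m (T₂ j)) x * ML (tabR m (T₃ j)) x)

/-- `Σ_j |s_j|` as an integer. [this work] -/
theorem absVec_cast {n : ℕ} (s : Fin n → ℤ) : ((absVec s : ℕ) : ℤ) = ∑ j, |s j| := by
  unfold absVec
  rw [Nat.cast_list_sum, List.map_ofFn, List.sum_ofFn]
  exact Finset.sum_congr rfl fun j _ => by simp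

set_option maxHeartbeats 800000 in
/-- **Soundness of `checkVec`**: if the digit test passes, the cubic polynomial of the term vector is nonnegative at every point of
the unit cube. [this work] -/
theorem checkVec_sound {σ m B n : ℕ} {s : Fin n → ℤ} {T₁ T₂ T₃ : Fin n → ℕ} (h : checkVec σ m B s T₁ T₂ T₃ = true)
    {x : Fin m → ℝ} (hx : InCube x) : 0 ≤ vecForm m s T₁ T₂ T₃ x := by
  unfold checkVec checkVecW at h
  simp only [Bool.and_eq_true, decide_eq_true_eq] at h
  obtain ⟨⟨⟨hσ, hbnd⟩, habs⟩, hZ, hland⟩ := h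
  have hoff : offT σ m = (maskN σ (4 ^ m) : ℤ) := by
    unfold offT
    rw [off_eq σ (4 ^ m) hσ, maskN_eq_sum σ hσ, Finset.mul_sum]
  rw [hoff] at hZ hland
  rw [Int.toNat_natCast] at hland
  set X : Fin n → (Fin m → Bool) → ℤ := fun j => tabZ m (T₁ j) with hXd
  set Y : Fin n → (Fin m → Bool) → ℤ := fun j => tabZ m (T₂ j) with hYd
  set W : Fin n → (Fin m → Bool) → ℤ := fun j => tabZ m (T₃ j) with hWd
  have hZeq : zVec σ m s T₁ T₂ T₃ = cubicZ (2 ^ σ) s X Y W := by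
    unfold zVec cubicZ
    rw [List.sum_ofFn]
    simp only [krT_eq, hXd, hYd, hWd]
  have habs' : ∑ j, |s j| ≤ (B : ℤ) := by rw [← absVec_cast]; exact_mod_cast habs
  have hB : CoefBound3 s X Y W (2 ^ (σ - 1)) := by
    intro k
    have h8 : ∀ j, |s j * pcoef3 (X j) (Y j) (W j) k| ≤ |s j| * 8 ^ m := by
      intro j
      rw [abs_mul]
      exact mul_le_mul_of_nonneg_left (abs_pcoef3_le _ _ _ (fun g => abs_tabZ_le _ _ _) (fun g => abs_tabZ_le _ _ _)
        (fun g => abs_tabZ_le _ _ _) k) (abs_nonneg _)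
    have hsum : |cubicCoef s X Y W k| ≤ (B : ℤ) * 8 ^ m := by
      unfold cubicCoef
      calc |∑ j, s j * pcoef3 (X j) (Y j) (W j) k|
          ≤ ∑ j, |s j * pcoef3 (X j) (Y j) (W j) k| := Finset.abs_sum_le_sum_abs _ _
        _ ≤ ∑ j, |s j| * (8 : ℤ) ^ m := Finset.sum_le_sum fun j _ => h8 j
        _ = (∑ j, |s j|) * 8 ^ m := by rw [Finset.sum_mul]
        _ ≤ (B : ℤ) * 8 ^ m := mul_le_mul_of_nonneg_right habs' (by positivity)
    have hpow : (B : ℤ) * 8 ^ m < (2 : ℕ) ^ (σ - 1) := by exact_mod_cast hbnd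
    exact lt_of_le_of_lt hsum hpow
  set N : ℕ := (zVec σ m s T₁ T₂ T₃ + maskN σ (4 ^ m)).toNat with hN
  have hNZ : (N : ℤ) = cubicZ (2 ^ σ) s X Y W + ∑ j : Fin (4 ^ m), (2 : ℤ) ^ (σ - 1) * (2 ^ σ) ^ (j : ℕ) := by
    rw [hN, Int.toNat_of_nonneg hZ, hZeq, maskN_eq_sum σ hσ, Fin.sum_univ_eq_sum_range
      (fun j => (2 : ℤ) ^ (σ - 1) * (2 ^ σ) ^ j) (4 ^ m)]
  have hdig : ∀ j : ℕ, j < 4 ^ m → 2 ^ (σ - 1) ≤ digit (2 ^ σ) N j := digit_ge_of_land σ hσ (4 ^ m) N hland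
  have hk : ∀ k, 0 ≤ cubicCoef s X Y W k := cubicCoef_nonneg_of_digit_ge hσ hB N hNZ hdig
  have hF : 0 ≤ cubicForm s X Y W x := cubicForm_nonneg hk hx
  unfold cubicForm at hF
  unfold vecForm tabR
  simp only [hXd, hYd, hWd] at hF
  exact hF

/-! ## The two certificates on the cube `2^3` -/

/-- The gate `[point i ∈ K]` of a bitmask. [this work] -/
def gate (K i : ℕ) : ℤ := if K.testBit i then 1 else 0

/-- `|gate| ≤ 1`, indeed `gate ∈ {0,1}`. [this work] -/
theorem gate_eq (K i : ℕ) : gate K i = 0 ∨ gate K i = 1 := by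
  unfold gate; split_ifs <;> simp

/-- Signs of the `a ∨ bc` certificate polynomial (`D = 21`, `C_a = 170`; last four terms gated by `K = X ∩ Z`). [this work] -/
def sOrAnd (X Z : ℕ) : Fin 12 → ℤ :=
  let K := X &&& Z
  ![6, 6, -6, -6, -6, -6, 6, 6, -6 * gate K 1, -6 * gate K 3, -6 * gate K 5, -6 * gate K 6]

/-- First tables of the `a ∨ bc` certificate polynomial. [this work] -/
def t1OrAnd (X Z : ℕ) : Fin 12 → ℕ :=
  let K := X &&& Z
  ![K, 21, X, 21, (21 &&& K), 21, X, Z, 1, 4, 16, 21]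

/-- Second tables of the `a ∨ bc` certificate polynomial. [this work] -/
def t2OrAnd (X Z : ℕ) : Fin 12 → ℕ :=
  let K := X &&& Z
  ![255, K, Z, X, 255, (21 &&& K), (21 &&& Z), (21 &&& X), 170, 170, 170, 64]

/-- Third tables of the `a ∨ bc` certificate polynomial. [this work] -/
def t3OrAnd (_X Z : ℕ) : Fin 12 → ℕ :=
  ![255, 255, 255, Z, 255, 255, 255, 255, 255, 255, 255, 255]

/-- Signs of the majority certificate polynomial (`D = 23`; last twelve terms gated by `K = X ∩ Z`). [this work] -/
def sMaj (X Z : ℕ) : Fin 20 → ℤ :=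
  let K := X &&& Z
  ![6, 6, -6, -6, -6, -6, 6, 6, -6 * gate K 3, -3 * gate K 3, -3 * gate K 3, -2 * gate K 3, -6 * gate K 5, -3 * gate K 5, -3 * gate K 5, -2 * gate K 5, -6 * gate K 6, -3 * gate K 6, -3 * gate K 6, -2 * gate K 6]

/-- First tables of the majority certificate polynomial. [this work] -/
def t1Maj (X Z : ℕ) : Fin 20 → ℕ :=
  let K := X &&& Z
  ![K, 23, X, 23, (23 &&& K), 23, X, Z, 23, 128, 128, 128, 23, 128, 128, 128, 23, 128, 128, 128]

/-- Second tables of the majority certificate polynomial. [this work] -/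
def t2Maj (X Z : ℕ) : Fin 20 → ℕ :=
  let K := X &&& Z
  ![255, K, Z, X, 255, (23 &&& K), (23 &&& Z), (23 &&& X), 8, 2, 4, 1, 32, 2, 16, 1, 64, 4, 16, 1]

/-- Third tables of the majority certificate polynomial. [this work] -/
def t3Maj (_X Z : ℕ) : Fin 20 → ℕ :=
  ![255, 255, 255, Z, 255, 255, 255, 255, 255, 255, 255, 255, 255, 255, 255, 255, 255, 255, 255, 255]

/-- The `a ∨ bc` check of one pair of bitmasks. [this work] -/
def checkOrAnd (σ X Z : ℕ) : Bool := checkVec σ 3 72 (sOrAnd X Z) (t1OrAnd X Z) (t2OrAnd X Z) (t3OrAnd X Z)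

/-- The majority check of one pair of bitmasks. [this work] -/
def checkMaj (σ X Z : ℕ) : Bool := checkVec σ 3 90 (sMaj X Z) (t1Maj X Z) (t2Maj X Z) (t3Maj X Z)

/-- One row of the `a ∨ bc` check: a fixed increasing bitmask `X` against all increasing `Z`. [this work] -/
def checkOrAndRow (σ X : ℕ) : Bool := (upsN 3).all fun Z => checkOrAnd σ X Z

/-- One row of the majority check. [this work] -/
def checkMajRow (σ X : ℕ) : Bool := (upsN 3).all fun Z => checkMaj σ X Z

section Rows
set_option maxRecDepth 100000
set_option maxHeartbeats 0

/-- Row `X = 0` of the `a ∨ bc` check (kernel evaluation). [this work] -/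
theorem checkOrAndRow_0 : checkOrAndRow 17 0 = true := by decide +kernel

/-- Row `X = 128` of the `a ∨ bc` check (kernel evaluation). [this work] -/
theorem checkOrAndRow_128 : checkOrAndRow 17 128 = true := by decide +kernel

/-- Row `X = 136` of the `a ∨ bc` check (kernel evaluation). [this work] -/
theorem checkOrAndRow_136 : checkOrAndRow 17 136 = true := by decide +kernel

/-- Row `X = 160` of the `a ∨ bc` check (kernel evaluation). [this work] -/
theorem checkOrAndRow_160 : checkOrAndRow 17 160 = true := by decide +kernel

/-- Row `X = 168` of the `a ∨ bc` check (kernel evaluation). [this work] -/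
theorem checkOrAndRow_168 : checkOrAndRow 17 168 = true := by decide +kernel

/-- Row `X = 170` of the `a ∨ bc` check (kernel evaluation). [this work] -/
theorem checkOrAndRow_170 : checkOrAndRow 17 170 = true := by decide +kernel

/-- Row `X = 192` of the `a ∨ bc` check (kernel evaluation). [this work] -/
theorem checkOrAndRow_192 : checkOrAndRow 17 192 = true := by decide +kernel

/-- Row `X = 200` of the `a ∨ bc` check (kernel evaluation). [this work] -/
theorem checkOrAndRow_200 : checkOrAndRow 17 200 = true := by decide +kernel

/-- Row `X = 204` of the `a ∨ bc` check (kernel evaluation). [this work] -/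
theorem checkOrAndRow_204 : checkOrAndRow 17 204 = true := by decide +kernel

/-- Row `X = 224` of the `a ∨ bc` check (kernel evaluation). [this work] -/
theorem checkOrAndRow_224 : checkOrAndRow 17 224 = true := by decide +kernel

/-- Row `X = 232` of the `a ∨ bc` check (kernel evaluation). [this work] -/
theorem checkOrAndRow_232 : checkOrAndRow 17 232 = true := by decide +kernel

/-- Row `X = 234` of the `a ∨ bc` check (kernel evaluation). [this work] -/
theorem checkOrAndRow_234 : checkOrAndRow 17 234 = true := by decide +kernel

/-- Row `X = 236` of the `a ∨ bc` check (kernel evaluation). [this work] -/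
theorem checkOrAndRow_236 : checkOrAndRow 17 236 = true := by decide +kernel

/-- Row `X = 238` of the `a ∨ bc` check (kernel evaluation). [this work] -/
theorem checkOrAndRow_238 : checkOrAndRow 17 238 = true := by decide +kernel

/-- Row `X = 240` of the `a ∨ bc` check (kernel evaluation). [this work] -/
theorem checkOrAndRow_240 : checkOrAndRow 17 240 = true := by decide +kernel

/-- Row `X = 248` of the `a ∨ bc` check (kernel evaluation). [this work] -/
theorem checkOrAndRow_248 : checkOrAndRow 17 248 = true := by decide +kernel

/-- Row `X = 250` of the `a ∨ bc` check (kernel evaluation). [this work] -/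
theorem checkOrAndRow_250 : checkOrAndRow 17 250 = true := by decide +kernel

/-- Row `X = 252` of the `a ∨ bc` check (kernel evaluation). [this work] -/
theorem checkOrAndRow_252 : checkOrAndRow 17 252 = true := by decide +kernel

/-- Row `X = 254` of the `a ∨ bc` check (kernel evaluation). [this work] -/
theorem checkOrAndRow_254 : checkOrAndRow 17 254 = true := by decide +kernel

/-- Row `X = 255` of the `a ∨ bc` check (kernel evaluation). [this work] -/
theorem checkOrAndRow_255 : checkOrAndRow 17 255 = true := by decide +kernel

/-- Row `X = 0` of the majority check (kernel evaluation). [this work] -/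
theorem checkMajRow_0 : checkMajRow 17 0 = true := by decide +kernel

/-- Row `X = 128` of the majority check (kernel evaluation). [this work] -/
theorem checkMajRow_128 : checkMajRow 17 128 = true := by decide +kernel

/-- Row `X = 136` of the majority check (kernel evaluation). [this work] -/
theorem checkMajRow_136 : checkMajRow 17 136 = true := by decide +kernel

/-- Row `X = 160` of the majority check (kernel evaluation). [this work] -/
theorem checkMajRow_160 : checkMajRow 17 160 = true := by decide +kernel

/-- Row `X = 168` of the majority check (kernel evaluation). [this work] -/
theorem checkMajRow_168 : checkMajRow 17 168 = true := by decide +kernel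

/-- Row `X = 170` of the majority check (kernel evaluation). [this work] -/
theorem checkMajRow_170 : checkMajRow 17 170 = true := by decide +kernel

/-- Row `X = 192` of the majority check (kernel evaluation). [this work] -/
theorem checkMajRow_192 : checkMajRow 17 192 = true := by decide +kernel

/-- Row `X = 200` of the majority check (kernel evaluation). [this work] -/
theorem checkMajRow_200 : checkMajRow 17 200 = true := by decide +kernel

/-- Row `X = 204` of the majority check (kernel evaluation). [this work] -/
theorem checkMajRow_204 : checkMajRow 17 204 = true := by decide +kernel

/-- Row `X = 224` of the majority check (kernel evaluation). [this work] -/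
theorem checkMajRow_224 : checkMajRow 17 224 = true := by decide +kernel

/-- Row `X = 232` of the majority check (kernel evaluation). [this work] -/
theorem checkMajRow_232 : checkMajRow 17 232 = true := by decide +kernel

/-- Row `X = 234` of the majority check (kernel evaluation). [this work] -/
theorem checkMajRow_234 : checkMajRow 17 234 = true := by decide +kernel

/-- Row `X = 236` of the majority check (kernel evaluation). [this work] -/
theorem checkMajRow_236 : checkMajRow 17 236 = true := by decide +kernel

/-- Row `X = 238` of the majority check (kernel evaluation). [this work] -/
theorem checkMajRow_238 : checkMajRow 17 238 = true := by decide +kernel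

/-- Row `X = 240` of the majority check (kernel evaluation). [this work] -/
theorem checkMajRow_240 : checkMajRow 17 240 = true := by decide +kernel

/-- Row `X = 248` of the majority check (kernel evaluation). [this work] -/
theorem checkMajRow_248 : checkMajRow 17 248 = true := by decide +kernel

/-- Row `X = 250` of the majority check (kernel evaluation). [this work] -/
theorem checkMajRow_250 : checkMajRow 17 250 = true := by decide +kernel

/-- Row `X = 252` of the majority check (kernel evaluation). [this work] -/
theorem checkMajRow_252 : checkMajRow 17 252 = true := by decide +kernel

/-- Row `X = 254` of the majority check (kernel evaluation). [this work] -/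
theorem checkMajRow_254 : checkMajRow 17 254 = true := by decide +kernel

/-- Row `X = 255` of the majority check (kernel evaluation). [this work] -/
theorem checkMajRow_255 : checkMajRow 17 255 = true := by decide +kernel

end Rows

/-- **The `a ∨ bc` certificate passes** on every pair of increasing bitmasks (base `2^17`, `20 × 20` pairs, by rows). [this work] -/
theorem checkOrAnd_of_mem {X Z : ℕ} (hX : X ∈ upsN 3) (hZ : Z ∈ upsN 3) : checkOrAnd 17 X Z = true := by
  have hrow : checkOrAndRow 17 X = true := by
    rw [SahiC4Cube.upsN_three] at hX
    simp only [List.mem_cons, List.not_mem_nil, or_false] at hX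
    rcases hX with rfl | rfl | rfl | rfl | rfl | rfl | rfl | rfl | rfl | rfl | rfl | rfl | rfl | rfl | rfl | rfl | rfl | rfl | rfl | rfl
    exacts [checkOrAndRow_0, checkOrAndRow_128, checkOrAndRow_136, checkOrAndRow_160, checkOrAndRow_168, checkOrAndRow_170, checkOrAndRow_192, checkOrAndRow_200, checkOrAndRow_204, checkOrAndRow_224, checkOrAndRow_232, checkOrAndRow_234, checkOrAndRow_236, checkOrAndRow_238, checkOrAndRow_240, checkOrAndRow_248, checkOrAndRow_250, checkOrAndRow_252, checkOrAndRow_254, checkOrAndRow_255]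
  unfold checkOrAndRow at hrow
  simp only [List.all_eq_true] at hrow
  exact hrow Z hZ

/-- **The majority certificate passes** on every pair of increasing bitmasks (base `2^17`, `20 × 20` pairs, by rows). [this work] -/
theorem checkMaj_of_mem {X Z : ℕ} (hX : X ∈ upsN 3) (hZ : Z ∈ upsN 3) : checkMaj 17 X Z = true := by
  have hrow : checkMajRow 17 X = true := by
    rw [SahiC4Cube.upsN_three] at hX
    simp only [List.mem_cons, List.not_mem_nil, or_false] at hX
    rcases hX with rfl | rfl | rfl | rfl | rfl | rfl | rfl | rfl | rfl | rfl | rfl | rfl | rfl | rfl | rfl | rfl | rfl | rfl | rfl | rfl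
    exacts [checkMajRow_0, checkMajRow_128, checkMajRow_136, checkMajRow_160, checkMajRow_168, checkMajRow_170, checkMajRow_192, checkMajRow_200, checkMajRow_204, checkMajRow_224, checkMajRow_232, checkMajRow_234, checkMajRow_236, checkMajRow_238, checkMajRow_240, checkMajRow_248, checkMajRow_250, checkMajRow_252, checkMajRow_254, checkMajRow_255]
  unfold checkMajRow at hrow
  simp only [List.all_eq_true] at hrow
  exact hrow Z hZ

/-! ## The checked polynomials, spelled out -/

/-- `w(T)`: the multilinear polynomial of a bitmask table of the `3`-cube. [this work] -/
noncomputable def mlT (T : ℕ) (x : Fin 3 → ℝ) : ℝ := ML (tabR 3 T) x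

/-- Six times the right-hand side of the transport condition:
`6·[(1+δ)(w(K) − w(X)w(Z) − w(D∩K)) + w(X)w(D∩Z) + w(Z)w(D∩X)]`, `K = X ∩ Z`, `δ = w(D)`. [this work] -/
noncomputable def rhs6 (D X Z : ℕ) (x : Fin 3 → ℝ) : ℝ :=
  6 * ((1 + mlT D x) * (mlT (X &&& Z) x - mlT X x * mlT Z x - mlT (D &&& (X &&& Z)) x)
    + mlT X x * mlT (D &&& Z) x + mlT Z x * mlT (D &&& X) x)

/-- Six times the transported mass into `K = X ∩ Z` for the `a ∨ bc` certificate. [this work] -/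
noncomputable def lhs6OrAnd (X Z : ℕ) (x : Fin 3 → ℝ) : ℝ :=
  (gate (X &&& Z) 1 : ℝ) * (6 * mlT 1 x * mlT 170 x) + (gate (X &&& Z) 3 : ℝ) * (6 * mlT 4 x * mlT 170 x)
    + (gate (X &&& Z) 5 : ℝ) * (6 * mlT 16 x * mlT 170 x) + (gate (X &&& Z) 6 : ℝ) * (6 * mlT 21 x * mlT 64 x)

/-- Six times the transported mass into `K = X ∩ Z` for the majority certificate. [this work] -/
noncomputable def lhs6Maj (X Z : ℕ) (x : Fin 3 → ℝ) : ℝ :=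
  (gate (X &&& Z) 3 : ℝ) * (6 * mlT 23 x * mlT 8 x + 3 * mlT 128 x * (mlT 2 x + mlT 4 x) + 2 * mlT 128 x * mlT 1 x)
    + (gate (X &&& Z) 5 : ℝ) * (6 * mlT 23 x * mlT 32 x + 3 * mlT 128 x * (mlT 2 x + mlT 16 x) + 2 * mlT 128 x * mlT 1 x)
    + (gate (X &&& Z) 6 : ℝ) * (6 * mlT 23 x * mlT 64 x + 3 * mlT 128 x * (mlT 4 x + mlT 16 x) + 2 * mlT 128 x * mlT 1 x)

/-- `w(full cube) = 1`. [this work] -/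
theorem mlT_full (x : Fin 3 → ℝ) : mlT 255 x = 1 := by
  have h := ML_fullN 3 x
  have e : fullN 3 = 255 := by norm_num [fullN]
  rw [e] at h
  exact h

set_option maxHeartbeats 800000 in
/-- The `a ∨ bc` term vector is `rhs6 − lhs6`. [this work] -/
theorem vecForm_orAnd (X Z : ℕ) (x : Fin 3 → ℝ) :
    vecForm 3 (sOrAnd X Z) (t1OrAnd X Z) (t2OrAnd X Z) (t3OrAnd X Z) x = rhs6 21 X Z x - lhs6OrAnd X Z x := by
  have hF : ML (tabR 3 255) x = 1 := mlT_full x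
  unfold vecForm rhs6 lhs6OrAnd mlT
  simp only [Fin.sum_univ_succ, Fin.sum_univ_zero, sOrAnd, t1OrAnd, t2OrAnd, t3OrAnd, Matrix.cons_val_zero, Matrix.cons_val_succ,
    hF]
  push_cast
  ring

set_option maxHeartbeats 800000 in
/-- The majority term vector is `rhs6 − lhs6`. [this work] -/
theorem vecForm_maj (X Z : ℕ) (x : Fin 3 → ℝ) :
    vecForm 3 (sMaj X Z) (t1Maj X Z) (t2Maj X Z) (t3Maj X Z) x = rhs6 23 X Z x - lhs6Maj X Z x := by
  have hF : ML (tabR 3 255) x = 1 := mlT_full x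
  unfold vecForm rhs6 lhs6Maj mlT
  simp only [Fin.sum_univ_succ, Fin.sum_univ_zero, sMaj, t1Maj, t2Maj, t3Maj, Matrix.cons_val_zero, Matrix.cons_val_succ, hF]
  push_cast
  ring

/-- **The transport condition for `a ∨ bc`, every pair of increasing bitmasks, every point of the cube.** [this work] -/
theorem tc_orAnd {X Z : ℕ} (hX : X ∈ upsN 3) (hZ : Z ∈ upsN 3) {x : Fin 3 → ℝ} (hx : InCube x) :
    lhs6OrAnd X Z x ≤ rhs6 21 X Z x := by
  have h := checkVec_sound (checkOrAnd_of_mem hX hZ) hx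
  rw [vecForm_orAnd] at h
  linarith

/-- **The transport condition for majority, every pair of increasing bitmasks, every point of the cube.** [this work] -/
theorem tc_maj {X Z : ℕ} (hX : X ∈ upsN 3) (hZ : Z ∈ upsN 3) {x : Fin 3 → ℝ} (hx : InCube x) :
    lhs6Maj X Z x ≤ rhs6 23 X Z x := by
  have h := checkVec_sound (checkMaj_of_mem hX hZ) hx
  rw [vecForm_maj] at h
  linarith

end Summit.CriticalPhenomena.PercolationContinuityZ3.Theorems.SahiTransportCheck
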